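import Literature.Computability.AlgebraicComplexity.LandsbergRessayrePairsProgram
import Literature.Computability.AlgebraicComplexity.GrenetEquivariant
import Literature.Computability.AlgebraicComplexity.DetReprEquivalent
import HarnessLib

/-!
# Landsberg–Ressayre's equivariant determinantal representation of the permanent, II:
# the signed minor (`det = m! · per_m`) and the two-sided torus (LR 2017, Prop. 2.10)

Topic `Literature/Computability/AlgebraicComplexity`; continues `LandsbergRessayrePairsProgram.lean`.
For the pairs branching program on `Fin m` with arc weights `X (i, j)` (adjacency matrix `A` given
by the hypothesis `hA`) and an enumeration `e` of the `N + 1 = C(2m,m)` vertices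
(`card_balancedPairs`: `∑_k C(n,k)² = C(2n,n)`; `odd_card_balancedPairs_sub_one`):
* `isAffineDetRepr_minor` — the signed `(snk, src)`-minor
  `M₀ = (-1)^(e snk + e src) • ((1 - A).submatrix …).submatrix (e snk).succAbove (e src).succAbove`
  (size `N = C(2m,m) - 1`, odd) is an affine determinantal representation of `m! · per_m`
  (Grenet's adjugate argument; LR absorb `m!` into `Λ₀`, we rescale a row in file IV);
* `linSubst_torus_apply`, `map_linSubst_torus_one_sub`, `exists_lift_torus` — the two-sided torus
  `X (p, q) ↦ d p · e q · X (p, q)` acts on `1 - A` by conjugation with the vertex scalings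
  `Λ(I, J) = ∏_{i ∈ I} d i · ∏_{j ∈ J} e j`, hence on `M₀` by constant invertible diagonal matrices
  (exact lift), as for Grenet's matrix in `GrenetEquivariant.lean`.
No definitions; nothing is asserted beyond what is proved. Honest framing: known construction.

## References

* J. M. Landsberg, N. Ressayre, *Permanent v. determinant: an exponential lower bound assuming
  symmetry and a potential path towards Valiant's conjecture*, Differential Geom. Appl. 55 (2017)
  146–166, arXiv:1508.05788: §2.3, Prop. 2.10 (held text `paper:arxiv-1508.05788` p0006);
  Thm. 2.1 (`edc(perm_m) = C(2m,m) - 1`, `m ≥ 3`). [LandsbergRessayre2017]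
* B. Grenet, *An upper bound for the permanent versus determinant problem* (2011), Thm. 1 — the
  one-sided model of the construction (tree: `PermanentVsDeterminantProofs.lean`,
  `GrenetEquivariant.lean`). [Grenet2011]
-/

noncomputable section

open MvPolynomial Matrix Finset

namespace Literature.Computability.AlgebraicComplexity

namespace LRPairs

variable {α : Type*} [Fintype α] [DecidableEq α]

/-! ### The number of nodes: `∑ₖ C(n,k)² = C(2n,n)` -/

omit [DecidableEq α] in
/-- **The pairs program has `C(2|α|, |α|)` vertices** (`dim ⊕_k (S^k E)_reg ⊗ (S^k F^*)_reg =
∑_k C(m,k)² = C(2m,m)`, LR 2017 Prop. 2.10: "so `n = C(2m,m) - 1 ∼ 4^m`" after merging source and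
sink). [cite: LandsbergRessayre2017, Prop. 2.10] -/
theorem card_balancedPairs [DecidableEq α] :
    Fintype.card {P : Finset α × Finset α // P.1.card = P.2.card} =
      (2 * Fintype.card α).choose (Fintype.card α) := by
  rw [Fintype.card_subtype, ← Nat.sum_range_choose_sq, ← Finset.univ_product_univ,
    Finset.card_filter, Finset.sum_product]
  have inner : ∀ I : Finset α,
      (∑ J : Finset α, if (I, J).1.card = (I, J).2.card then 1 else 0) =
        (Fintype.card α).choose I.card := by
    intro I
    rw [← Finset.card_filter, ← Finset.card_univ, ← Finset.card_powersetCard,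
      Finset.powersetCard_eq_filter, Finset.powerset_univ]
    congr 1
    ext J
    simp [eq_comm]
  simp_rw [inner]
  rw [← Finset.powerset_univ, Finset.sum_powerset_apply_card, Finset.card_univ]
  refine sum_congr rfl fun k _ => ?_
  rw [smul_eq_mul, sq]

omit [DecidableEq α] in
/-- For nonempty `α` the number of vertices `C(2|α|, |α|)` is even, so the size
`N = C(2|α|, |α|) - 1` of the merged program is odd. [folklore] -/
private theorem odd_card_balancedPairs_sub_one [DecidableEq α] [Nonempty α] {N : ℕ}
    (hN : Fintype.card {P : Finset α × Finset α // P.1.card = P.2.card} = N + 1) : Odd N := by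
  rw [card_balancedPairs] at hN
  have h2 : 2 ∣ (2 * Fintype.card α).choose (Fintype.card α) :=
    Nat.two_dvd_centralBinom_of_one_le Fintype.card_pos
  rw [hN] at h2
  rcases Nat.even_or_odd N with hE | hO
  · exfalso
    obtain ⟨r, hr⟩ := hE
    omega
  · exact hO

/-! ### The signed minor is an affine determinantal representation of `m! · per_m` -/

section Minor

variable {k : Type*} [CommRing k] [Nontrivial k] {m : ℕ}

/-- The entries of `1 - A` are affine (`0`, `1` or a sum of variables `X (i, j)`). [folklore] -/
private theorem totalDegree_one_sub_le
    {A : Matrix {P : Finset (Fin m) × Finset (Fin m) // P.1.card = P.2.card}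
      {P : Finset (Fin m) × Finset (Fin m) // P.1.card = P.2.card} (MvPolynomial (Fin m × Fin m) k)}
    (hA : ∀ P Q, A P Q = ∑ i, ∑ j,
      if i ∉ P.1.1 ∧ j ∉ P.1.2 ∧ Q.1 = (insert i P.1.1, insert j P.1.2) then X (i, j) else 0)
    (S T : {P : Finset (Fin m) × Finset (Fin m) // P.1.card = P.2.card}) :
    ((1 - A) S T).totalDegree ≤ 1 := by
  rw [Matrix.sub_apply]
  refine (totalDegree_sub _ _).trans (max_le ?_ ?_)
  · rw [Matrix.one_apply]
    split_ifs <;> simp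
  · rw [hA]
    refine totalDegree_finsetSum_le fun i _ => totalDegree_finsetSum_le fun j _ => ?_
    split_ifs
    · exact (totalDegree_X _).le
    · simp

/-- **The signed `(snk, src)`-minor of `1 - A` is an affine determinantal representation of
`m! · per_m`** (size `N = C(2m,m) - 1`): its `(src, snk)` cofactor is the path sum `m! · per_m`
(`adjugate_one_sub_src_snk`, `sum_sum_ite_injective_prod_X`), the sign `(-1)^(e snk + e src)` is
absorbed because `N` is odd. (LR 2017 Prop. 2.10 remove the factor `m!` by rescaling `Λ₀`; here a
row is rescaled afterwards, `LandsbergRessayrePairsEquivariant.lean`.) [cite: LandsbergRessayre2017, Prop. 2.10] -/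
theorem isAffineDetRepr_minor (hm : m ≠ 0)
    {A : Matrix {P : Finset (Fin m) × Finset (Fin m) // P.1.card = P.2.card}
      {P : Finset (Fin m) × Finset (Fin m) // P.1.card = P.2.card} (MvPolynomial (Fin m × Fin m) k)}
    (hA : ∀ P Q, A P Q = ∑ i, ∑ j,
      if i ∉ P.1.1 ∧ j ∉ P.1.2 ∧ Q.1 = (insert i P.1.1, insert j P.1.2) then X (i, j) else 0)
    {N : ℕ} (hN : Fintype.card {P : Finset (Fin m) × Finset (Fin m) // P.1.card = P.2.card} = N + 1)
    (e : {P : Finset (Fin m) × Finset (Fin m) // P.1.card = P.2.card} ≃ Fin (N + 1)) :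
    IsAffineDetRepr ((m.factorial : MvPolynomial (Fin m × Fin m) k) * perPoly (Fin m) k)
      ((-1 : MvPolynomial (Fin m × Fin m) k) ^
          ((e ⟨(univ, univ), rfl⟩ : ℕ) + (e ⟨(∅, ∅), rfl⟩ : ℕ)) •
        ((1 - A).submatrix e.symm e.symm).submatrix (e ⟨(univ, univ), rfl⟩).succAbove
          (e ⟨(∅, ∅), rfl⟩).succAbove) := by
  haveI : Nonempty (Fin m) := ⟨⟨0, Nat.pos_of_ne_zero hm⟩⟩
  have hadj : ((1 - A).submatrix e.symm e.symm).adjugate (e ⟨(∅, ∅), rfl⟩) (e ⟨(univ, univ), rfl⟩) =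
      (m.factorial : MvPolynomial (Fin m × Fin m) k) * perPoly (Fin m) k := by
    rw [Matrix.adjugate_submatrix_equiv_self, Matrix.submatrix_apply, e.symm_apply_apply,
      e.symm_apply_apply, adjugate_one_sub_src_snk (fun i j => X (i, j)) hA,
      sum_sum_ite_injective_prod_X, Fintype.card_fin, nsmul_eq_mul]
  rw [Matrix.adjugate_fin_succ_eq_det_submatrix] at hadj
  have hodd : Odd N := odd_card_balancedPairs_sub_one hN
  refine ⟨?_, ?_⟩
  · intro p q
    rw [Matrix.smul_apply, smul_eq_mul]
    refine (totalDegree_mul _ _).trans ?_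
    have h1 : ((-1 : MvPolynomial (Fin m × Fin m) k) ^
        ((e ⟨(univ, univ), rfl⟩ : ℕ) + (e ⟨(∅, ∅), rfl⟩ : ℕ))).totalDegree = 0 := by
      refine Nat.eq_zero_of_le_zero ((totalDegree_pow _ _).trans ?_)
      rw [totalDegree_neg, totalDegree_one, mul_zero]
    rw [h1, zero_add]
    exact totalDegree_one_sub_le hA _ _
  · rw [Matrix.det_smul, Fintype.card_fin, ← pow_mul, pow_mul', hodd.neg_one_pow]
    exact hadj

end Minor


/-! ## Part B — exact lifts of the symmetries of `per_m` -/

/-! ### The two-sided torus acts by the vertex scalings `Λ(I, J) = ∏_{i ∈ I} d i · ∏_{j ∈ J} e j` -/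

section Torus

variable {k : Type*} [Field k] {m : ℕ}

/-- **The torus substitution `X (p, q) ↦ d p · e q · X (p, q)` acts on the adjacency matrix by
the vertex scalings** `Λ(I, J) = ∏_{i ∈ I} d i · ∏_{j ∈ J} e j`:
`A(γ · x) P Q = Λ(P)⁻¹ Λ(Q) · A P Q` (an arc `(I, J) → (I ∪ i, J ∪ j)` scales by `d i · e j`).
[cite: LandsbergRessayre2017, Prop. 2.10] -/
theorem linSubst_torus_apply {d e : Fin m → k} (hd : ∀ i, d i ≠ 0) (he : ∀ j, e j ≠ 0)
    {A : Matrix {P : Finset (Fin m) × Finset (Fin m) // P.1.card = P.2.card}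
      {P : Finset (Fin m) × Finset (Fin m) // P.1.card = P.2.card} (MvPolynomial (Fin m × Fin m) k)}
    (hA : ∀ P Q, A P Q = ∑ i, ∑ j,
      if i ∉ P.1.1 ∧ j ∉ P.1.2 ∧ Q.1 = (insert i P.1.1, insert j P.1.2) then X (i, j) else 0)
    (P Q : {P : Finset (Fin m) × Finset (Fin m) // P.1.card = P.2.card}) :
    linSubst (Fin m × Fin m) k (Matrix.diagonal fun p : Fin m × Fin m => d p.1 * e p.2) (A P Q) =
      C (((∏ i ∈ P.1.1, d i) * ∏ j ∈ P.1.2, e j)⁻¹ * ((∏ i ∈ Q.1.1, d i) * ∏ j ∈ Q.1.2, e j)) *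
        A P Q := by
  rw [hA, map_sum, Finset.mul_sum]
  refine sum_congr rfl fun i _ => ?_
  rw [map_sum, Finset.mul_sum]
  refine sum_congr rfl fun j _ => ?_
  by_cases h : i ∉ P.1.1 ∧ j ∉ P.1.2 ∧ Q.1 = (insert i P.1.1, insert j P.1.2)
  · rw [if_pos h]
    obtain ⟨hi, hj, hQ⟩ := h
    have hQ1 : Q.1.1 = insert i P.1.1 := by rw [hQ]
    have hQ2 : Q.1.2 = insert j P.1.2 := by rw [hQ]
    have hP : (∏ i ∈ P.1.1, d i) * ∏ j ∈ P.1.2, e j ≠ 0 :=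
      mul_ne_zero (prod_ne_zero_iff.mpr fun i _ => hd i) (prod_ne_zero_iff.mpr fun j _ => he j)
    rw [Grenet.linSubst_diagonal_X, hQ1, hQ2, prod_insert hi, prod_insert hj,
      MvPolynomial.smul_eq_C_mul,
      show (d i * ∏ i ∈ P.1.1, d i) * (e j * ∏ j ∈ P.1.2, e j) =
        ((∏ i ∈ P.1.1, d i) * ∏ j ∈ P.1.2, e j) * (d i * e j) by ring,
      inv_mul_cancel_left₀ hP]
  · rw [if_neg h, map_zero, mul_zero]

/-- Matrix form: `(1 - A)(γ · x) = Λ⁻¹ · (1 - A) · Λ` with `Λ = diagonal (C ∘ Λ)`.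
[cite: LandsbergRessayre2017, Prop. 2.10] -/
theorem map_linSubst_torus_one_sub {d e : Fin m → k} (hd : ∀ i, d i ≠ 0) (he : ∀ j, e j ≠ 0)
    {A : Matrix {P : Finset (Fin m) × Finset (Fin m) // P.1.card = P.2.card}
      {P : Finset (Fin m) × Finset (Fin m) // P.1.card = P.2.card} (MvPolynomial (Fin m × Fin m) k)}
    (hA : ∀ P Q, A P Q = ∑ i, ∑ j,
      if i ∉ P.1.1 ∧ j ∉ P.1.2 ∧ Q.1 = (insert i P.1.1, insert j P.1.2) then X (i, j) else 0) :
    (1 - A).map (linSubst (Fin m × Fin m) k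
        (Matrix.diagonal fun p : Fin m × Fin m => d p.1 * e p.2)) =
      Matrix.diagonal (fun S : {P : Finset (Fin m) × Finset (Fin m) // P.1.card = P.2.card} =>
          C ((∏ i ∈ S.1.1, d i) * ∏ j ∈ S.1.2, e j)⁻¹) * (1 - A) *
        Matrix.diagonal (fun T => C ((∏ i ∈ T.1.1, d i) * ∏ j ∈ T.1.2, e j)) := by
  refine Matrix.ext fun S T => ?_
  rw [Matrix.map_apply, Matrix.sub_apply, map_sub, linSubst_torus_apply hd he hA,
    Matrix.mul_diagonal, Matrix.diagonal_mul, Matrix.sub_apply, Matrix.one_apply, map_mul]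
  by_cases hST : S = T
  · subst hST
    have hS : (∏ i ∈ S.1.1, d i) * ∏ j ∈ S.1.2, e j ≠ 0 :=
      mul_ne_zero (prod_ne_zero_iff.mpr fun i _ => hd i) (prod_ne_zero_iff.mpr fun j _ => he j)
    have h1 : (C ((∏ i ∈ S.1.1, d i) * ∏ j ∈ S.1.2, e j)⁻¹ : MvPolynomial (Fin m × Fin m) k) *
        C ((∏ i ∈ S.1.1, d i) * ∏ j ∈ S.1.2, e j) = 1 := by
      rw [← map_mul, inv_mul_cancel₀ hS, map_one]
    rw [if_pos rfl, map_one]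
    linear_combination -h1
  · rw [if_neg hST, map_zero]
    ring

/-- **The torus substitution on the signed minor is a two-sided diagonal scaling**
`M₀(γ · x) = Λ_rows⁻¹ · M₀ · Λ_cols`, with the vertex scalings of the surviving rows (`≠ snk`) and
columns (`≠ src`); in particular it lifts exactly to constant invertible `(P, Q)`.
[cite: LandsbergRessayre2017, Prop. 2.10] -/
theorem exists_lift_torus {d e : Fin m → k} (hd : ∀ i, d i ≠ 0) (he : ∀ j, e j ≠ 0)
    {A : Matrix {P : Finset (Fin m) × Finset (Fin m) // P.1.card = P.2.card}
      {P : Finset (Fin m) × Finset (Fin m) // P.1.card = P.2.card} (MvPolynomial (Fin m × Fin m) k)}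
    (hA : ∀ P Q, A P Q = ∑ i, ∑ j,
      if i ∉ P.1.1 ∧ j ∉ P.1.2 ∧ Q.1 = (insert i P.1.1, insert j P.1.2) then X (i, j) else 0)
    {N : ℕ} (eqv : {P : Finset (Fin m) × Finset (Fin m) // P.1.card = P.2.card} ≃ Fin (N + 1))
    (γ : GL (Fin m × Fin m) k)
    (hγ : (γ : Matrix (Fin m × Fin m) (Fin m × Fin m) k) = Matrix.diagonal fun p => d p.1 * e p.2) :
    ∃ P Q : GL (Fin N) k,
      Matrix.linSubstEntries γ
        ((-1 : MvPolynomial (Fin m × Fin m) k) ^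
            ((eqv ⟨(univ, univ), rfl⟩ : ℕ) + (eqv ⟨(∅, ∅), rfl⟩ : ℕ)) •
          ((1 - A).submatrix eqv.symm eqv.symm).submatrix (eqv ⟨(univ, univ), rfl⟩).succAbove
            (eqv ⟨(∅, ∅), rfl⟩).succAbove) =
      (P : Matrix (Fin N) (Fin N) k).map C *
        ((-1 : MvPolynomial (Fin m × Fin m) k) ^
            ((eqv ⟨(univ, univ), rfl⟩ : ℕ) + (eqv ⟨(∅, ∅), rfl⟩ : ℕ)) •
          ((1 - A).submatrix eqv.symm eqv.symm).submatrix (eqv ⟨(univ, univ), rfl⟩).succAbove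
            (eqv ⟨(∅, ∅), rfl⟩).succAbove) *
        (Q : Matrix (Fin N) (Fin N) k).map C := by
  set Λ : {P : Finset (Fin m) × Finset (Fin m) // P.1.card = P.2.card} → k :=
    fun S => (∏ i ∈ S.1.1, d i) * ∏ j ∈ S.1.2, e j with hΛ
  have hΛne : ∀ S, Λ S ≠ 0 := fun S =>
    mul_ne_zero (prod_ne_zero_iff.mpr fun i _ => hd i) (prod_ne_zero_iff.mpr fun j _ => he j)
  refine ⟨Grenet.diagUnit (fun i => (Λ (eqv.symm ((eqv ⟨(univ, univ), rfl⟩).succAbove i)))⁻¹)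
      (fun i => inv_ne_zero (hΛne _)),
    Grenet.diagUnit (fun j => Λ (eqv.symm ((eqv ⟨(∅, ∅), rfl⟩).succAbove j)))
      (fun j => hΛne _), ?_⟩
  rw [Grenet.val_diagUnit, Grenet.val_diagUnit, Matrix.diagonal_map (map_zero C),
    Matrix.diagonal_map (map_zero C)]
  unfold Matrix.linSubstEntries
  rw [hγ]
  set F := linSubst (Fin m × Fin m) k (Matrix.diagonal fun p : Fin m × Fin m => d p.1 * e p.2)
    with hF
  have hsign : F ((-1 : MvPolynomial (Fin m × Fin m) k) ^
      ((eqv ⟨(univ, univ), rfl⟩ : ℕ) + (eqv ⟨(∅, ∅), rfl⟩ : ℕ))) =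
      (-1 : MvPolynomial (Fin m × Fin m) k) ^
        ((eqv ⟨(univ, univ), rfl⟩ : ℕ) + (eqv ⟨(∅, ∅), rfl⟩ : ℕ)) := by
    rw [map_pow, map_neg, map_one]
  rw [Matrix.map_smul' _ _ _ (map_mul F), hsign, ← Matrix.submatrix_map, ← Matrix.submatrix_map, hF,
    map_linSubst_torus_one_sub hd he hA,
    Grenet.submatrix_diagonal_mul_mul_diagonal _ _ _ eqv.symm eqv.symm,
    Grenet.submatrix_diagonal_mul_mul_diagonal _ _ _ (eqv ⟨(univ, univ), rfl⟩).succAbove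
      (eqv ⟨(∅, ∅), rfl⟩).succAbove,
    Matrix.mul_smul, Matrix.smul_mul]
  rfl

end Torus

end LRPairs

end Literature.Computability.AlgebraicComplexity
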